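import Mathlib.Topology.Instances.RealVectorSpace
import Mathlib.Analysis.Normed.Group.Uniform
import Mathlib.Analysis.Complex.Norm
import Literature.MathematicalPhysics.QuantumFieldTheory.Balaban1983to89.T4HistoryLipschitzRecursion

/-!
# NE9ChannelRealLinear — an ADDITIVE, SIZE-BOUNDED localization channel on an admissible class closed under real scalars is
# ℝ-LINEAR there (Cauchy's functional equation under a linear bound), hence COMPLEXIFIES to a ℂ-linear reading with the same
# creation-step weights ×√2: route R4's structural binder (O-R4-1) ∕ falsifier P-R4-5 DERIVED from the END of record's binders

Cell `pub-balaban`, T4-DAG §2 node U3 ∕ §6 NE9; BINDER row NE9 OWNER lineage `b2b-balaban-t4-ne9-p1`, generation 60; CRUX PROVER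
NE9 under the coordinator ruling «YM REDIRECT» e34b3e0c (2), route R4 «fading by Earle–Hamilton» of `t4/ROUTES-NE9.md` v4
(§L1.0, §V4 (3) obligation (O-R4-1), falsifier P-R4-5), INTERFACE REQUEST NE9 (R4-4) of HOME/INBOX.md 2026-08-21T06:2xZ ∕ journal
l.28192 — the record-level discharger of the future-influence instance's binder (B2) «ℂ-LINEAR per-slice readings».

HONEST FRAMING (T4-DAG PAGE 1).  Rung (B)+1 of the FINITE-VOLUME T⁴ programme — NOT infinite volume, NOT a mass gap, NOT the
Clay problem.  NE9 (`T4OutputRate.NE9` ∧ `FadingMemory`) is a cell NEW ESTIMATE, NOT PRINTED in [I] = [Balaban1987RG1]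
(CMP **109**), [II] = [Balaban1988RG2Cluster] (CMP **116**), and NOT PROVED for Bałaban's E^{(j)} («NE9 ⇐ the named binders»;
row WALLED ON A MODEL O-NE9-1; spine PROVED 0∕9).  HONEST DEPENDENCY (cell line, verbatim): continuum YM on T⁴ ⇐ BetaPertH ∧
nine spine estimates (0/9 proved); BetaPertH ⇐ (D1) ∧ (D4) ∧ CAP+tail; G-an2-4 gates asym, D1 and NE2/3/4.  `FlowStep.BetaPertH`,
(B), (B^μ) do not occur.  Elementary real∕complex bookkeeping on the BINDER SHAPES of `T4HistoryLipschitzRecursion` §6–§8; no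
`def`, no Prop-valued definition, no estimate of any object of the series; [II] quoted for TYPES only (ABSOLUTE RULE).  0 sorry.

WHY THIS LEAF.  Route R4's state-space instance (K2♭, leaf-04 g45 `NE9FutureInfluenceInstance` 56445b4012700b9d; step shape
`S k g (y,x) = (τ₀•Φ k (g k) (x⟨0,g⟩), ω̂•shift x + J k (Φ …))`) files the future channel profile of each new slice through
ℂ-LINEAR bounded readings `Rd m j s : 𝔜 →L[ℂ] Pot` with `‖Rd (j+n) j s‖ ≤ τ₀ωⁿ` (binder (B2)), whereas the END of record (T31
`NE9EndOfRecordPoints`, the pencil END `NE9TwoPointKPOfPencil` §3) carries the channel `T : ℕ → (ℕ → ℝ) → (Bg → C.Dom → ℝ) → ι → ℝ`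
with ADDITIVITY on the admissible class only (`ChannelAdditive Adm T`, printed structure: [II] (1.23) p. 7 is linear in the old
term, (1.33) p. 9 sums the pieces) and the creation-step-weighted SIZE bound (`ChannelSizeAtStepNN`, TYPE (1.36) p. 9 with p. 8
l. 9–10) — NO homogeneity binder (falsifier P-R4-5 of ROUTES-NE9 v4; leaf-04's flagged «EXTRA structural binder»).  THIS FILE
proves that ℝ-homogeneity is NOT an extra binder: on a class closed under differences and real scalar multiples (TRUE BY
INSPECTION for every class of record — `NE9Lemma1RemainderSpecies.analyticClass R` is an ℝ-subspace), an additive channel whose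
output on each family is bounded LINEARLY in the family's size profile is ℝ-LINEAR on every family WITH a finite profile
(§1–§2: along the ray `c ↦ T k s (c•H) y` the channel is an additive real function bounded by `K·|c|`, hence `c·T k s H y` —
Mathlib's `map_real_smul` after `AddMonoidHomClass.continuous_of_bound`); consequently the CANONICAL COMPLEXIFICATION
`(H₁, H₂) ↦ T k s H₁ y + i·T k s H₂ y` is ℂ-linear (§3) and obeys the SAME creation-step-weighted bound with the factor `√2`
(§4: real and imaginary parts separately; `Complex.norm_le_sqrt_two_mul_max`) — the entries of binder (B2)'s reading before
the (1.36)-weighted packing into `Pot = lp (fun _ : ι => ℂ) ∞` (`NE9TableReading`), which is the instancer's next line.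
* §1 `eq_mul_of_additive_of_abs_le` — Cauchy's functional equation on ℝ under `|φ c| ≤ K·|c|`.
* §2 `add_mem_of_closed`, `zero_mem_of_closed`, `channel_zero`, `channel_add`, `channel_neg`, **`channel_smul`** (class-level
  size `ChannelSizeNN`, profile on the scales ≤ k), **`channel_smul_atStep`** (per-creation-step size `ChannelSizeAtStepNN`,
  family supported at one scale j ≤ k — the per-slice form K2♭'s `Rd (j+n) j s` consumes).
* §3 **`channel_complex_linear_atStep`** ∕ `channel_complex_linear` — `T^ℂ(z•(H₁,H₂)) = z·T^ℂ(H₁,H₂)` for `z = a + bi`, written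
  on the pair `(a•H₁ − b•H₂, a•H₂ + b•H₁)`; `channel_complex_add`.
* §4 **`norm_channel_complex_le_atStep`** ∕ `norm_channel_complex_le` — `‖(T k s H₁ y, T k s H₂ y)‖_ℂ ≤ √2·wt k y·(τ k j·N)`
  (resp. `√2·wt k y·Σ_{j≤k} τ k j·N j`) when both parts carry the profile; `…_of_complexBound` — the same from a bound on the
  complex modulus `‖(H₁ U X, H₂ U X)‖ ≤ e^{−κd(X)}·N`.
DISGUISE TEST: one channel, one family (or one pair), scalars — no history, no two couplings, no renormalised term; not NE9.
WHAT THIS DOES NOT DO: it builds no reading `𝔜 →L[ℂ] Pot` (needs the slice space 𝔜 of record — the owner's next docking file),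
touches no activity, no species, no estimate of Bałaban's; the closure of `Adm` under real scalars is a DISPLAYED hypothesis
(`hsmul`), discharged by inspection at each class of record, not here.

References (TYPES only): [Balaban1988RG2Cluster] T. Bałaban, Renormalization group approach to lattice gauge field theories.
II. Cluster expansions, Commun. Math. Phys. **116** (1988) 1–22 — (1.23) p. 7, p. 8 l. 9–10, (1.33) and (1.36) p. 9;
[Balaban1987RG1] T. Bałaban, Renormalization group approach to lattice gauge field theories. I, Commun. Math. Phys. **109** (1987)
249–301 — (0.23) p. 256, (2.12)–(2.13) p. 268.  Summits-side NEW work (LEAN PLACEMENT RULE); imports Mathlib and the Literature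
module `T4HistoryLipschitzRecursion` (binder shapes) BY NAME; modifies nothing; 0 sorry.  Value = route R4's one structural
binder made a CONSEQUENCE of the END of record's binders (P-R4-5 closed in kernel), NOT summit progress.
-/

namespace Summit.QuantumFields.BalabanUV.T4Continuum.NE9ChannelRealLinear

open scoped BigOperators
open Literature.MathematicalPhysics.QuantumFieldTheory.Balaban1983to89
open Literature.MathematicalPhysics.QuantumFieldTheory.Balaban1983to89.T4OutputRate
open Literature.MathematicalPhysics.QuantumFieldTheory.Balaban1983to89.T4HistoryLipschitzRecursion

/-! ## §1 Cauchy's functional equation under a linear bound -/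

/-- [folklore] **AN ADDITIVE REAL FUNCTION BOUNDED BY `K·|c|` IS LINEAR**: `φ (a + b) = φ a + φ b` for all reals and
`|φ c| ≤ K·|c|` ⇒ `φ c = c·φ 1`.  (The bound makes the additive homomorphism continuous —
`AddMonoidHomClass.continuous_of_bound` —, and a continuous additive self-map of ℝ is ℝ-linear — `map_real_smul`.) -/
theorem eq_mul_of_additive_of_abs_le {φ : ℝ → ℝ} (hadd : ∀ a b : ℝ, φ (a + b) = φ a + φ b) {K : ℝ}
    (hK : ∀ c : ℝ, |φ c| ≤ K * |c|) (c : ℝ) : φ c = c * φ 1 := by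
  let f : ℝ →+ ℝ := AddMonoidHom.mk' φ hadd
  have hcont : Continuous f :=
    AddMonoidHomClass.continuous_of_bound f K fun x => by
      simpa only [f, AddMonoidHom.mk'_apply, Real.norm_eq_abs] using hK x
  have key := map_real_smul f hcont c 1
  simpa only [f, AddMonoidHom.mk'_apply, smul_eq_mul, mul_one] using key

/-! ## §2 The channel along a ray: ℝ-homogeneity from additivity and the size bound -/

section Channel

variable {C : Carriers} {Bg ι : Type} {Adm : Set (Bg → C.Dom → ℝ)}
  {T : ℕ → (ℕ → ℝ) → (Bg → C.Dom → ℝ) → ι → ℝ} {κ : ℝ} {wt : ℕ → ι → ℝ} {τ : ℕ → ℕ → ℝ}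

/-- [folklore] A class closed under differences and real scalar multiples is closed under sums (`H₁ + H₂ = H₁ − (−1)•H₂`). -/
theorem add_mem_of_closed (hsub : ∀ H₁ ∈ Adm, ∀ H₂ ∈ Adm, H₁ - H₂ ∈ Adm) (hsmul : ∀ (c : ℝ), ∀ H ∈ Adm, c • H ∈ Adm)
    {H₁ H₂ : Bg → C.Dom → ℝ} (h₁ : H₁ ∈ Adm) (h₂ : H₂ ∈ Adm) : H₁ + H₂ ∈ Adm := by
  have h : H₁ + H₂ = H₁ - (-1 : ℝ) • H₂ := by
    rw [neg_one_smul, sub_neg_eq_add]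
  rw [h]
  exact hsub H₁ h₁ _ (hsmul (-1) H₂ h₂)

/-- [folklore] A NONEMPTY class closed under differences contains the zero family. -/
theorem zero_mem_of_closed (hsub : ∀ H₁ ∈ Adm, ∀ H₂ ∈ Adm, H₁ - H₂ ∈ Adm) {H : Bg → C.Dom → ℝ} (hH : H ∈ Adm) :
    (0 : Bg → C.Dom → ℝ) ∈ Adm := by
  simpa only [sub_self] using hsub H hH H hH

/-- [folklore] **AN ADDITIVE CHANNEL KILLS THE ZERO FAMILY** (on a nonempty class): `T k s 0 y = 0`. -/
theorem channel_zero (hadd : ChannelAdditive Adm T) {H : Bg → C.Dom → ℝ} (hH : H ∈ Adm) (k : ℕ) (s : ℕ → ℝ) (y : ι) :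
    T k s 0 y = 0 := by
  have h := hadd k s H hH H hH y
  rwa [sub_self, sub_self] at h

/-- [folklore] **ADDITIVITY ON SUMS** (the binder states it on differences): `T k s (H₁ + H₂) y = T k s H₁ y + T k s H₂ y` on a
class closed under differences and real scalars. -/
theorem channel_add (hadd : ChannelAdditive Adm T) (hsub : ∀ H₁ ∈ Adm, ∀ H₂ ∈ Adm, H₁ - H₂ ∈ Adm)
    (hsmul : ∀ (c : ℝ), ∀ H ∈ Adm, c • H ∈ Adm) {H₁ H₂ : Bg → C.Dom → ℝ} (h₁ : H₁ ∈ Adm) (h₂ : H₂ ∈ Adm) (k : ℕ)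
    (s : ℕ → ℝ) (y : ι) : T k s (H₁ + H₂) y = T k s H₁ y + T k s H₂ y := by
  have h := hadd k s (H₁ + H₂) (add_mem_of_closed hsub hsmul h₁ h₂) H₂ h₂ y
  rw [add_sub_cancel_right] at h
  linarith

/-- [folklore] **ADDITIVITY ON NEGATIVES**: `T k s (−H) y = −T k s H y`. -/
theorem channel_neg (hadd : ChannelAdditive Adm T) (hsub : ∀ H₁ ∈ Adm, ∀ H₂ ∈ Adm, H₁ - H₂ ∈ Adm)
    {H : Bg → C.Dom → ℝ} (hH : H ∈ Adm) (k : ℕ) (s : ℕ → ℝ) (y : ι) : T k s (-H) y = -T k s H y := by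
  have h := hadd k s 0 (zero_mem_of_closed hsub hH) H hH y
  rwa [zero_sub, channel_zero hadd hH, zero_sub] at h

/-- [folklore] The size profile of a real multiple: `|(c•H) U X| ≤ e^{−κd(X)}·(|c|·N)` from `|H U X| ≤ e^{−κd(X)}·N`. -/
theorem abs_smul_apply_le {H : Bg → C.Dom → ℝ} {U : Bg} {X : C.Dom} {N : ℝ} (c : ℝ)
    (h : |H U X| ≤ Real.exp (-(κ * C.d X)) * N) : |(c • H) U X| ≤ Real.exp (-(κ * C.d X)) * (|c| * N) := by
  rw [Pi.smul_apply, Pi.smul_apply, smul_eq_mul, abs_mul, mul_left_comm]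
  exact mul_le_mul_of_nonneg_left h (abs_nonneg c)

/-- **THE CHANNEL IS ℝ-HOMOGENEOUS ON THE ADMISSIBLE CLASS** (class-level size form): `ChannelAdditive Adm T`, the guarded
weighted size bound `ChannelSizeNN Adm T κ wt τ`, `Adm` closed under differences and real scalars, and a family `H ∈ Adm` with a
finite nonnegative size profile `N` on the creation steps `≤ k` ⇒ `T k s (c•H) y = c·T k s H y` for every real `c`.  Along the
ray, `c ↦ T k s (c•H) y` is additive (the binder at `(a+b)•H` and `b•H`) and bounded by `(wt k y·Σ_{j≤k} τ k j·N j)·|c|` (the size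
binder at `c•H`, profile `|c|·N`), so §1 applies.  No estimate of Bałaban's: the printed TYPE behind the binders is [II] (1.23)
p. 7 (linear in the old term) and (1.36) p. 9 (linear in E₀). [cite: Balaban1988RG2Cluster, (1.23) p.7 and (1.36) p.9] -/
theorem channel_smul (hadd : ChannelAdditive Adm T) (hsize : ChannelSizeNN Adm T κ wt τ)
    (hsmul : ∀ (c : ℝ), ∀ H ∈ Adm, c • H ∈ Adm)
    {H : Bg → C.Dom → ℝ} (hH : H ∈ Adm) (k : ℕ) (s : ℕ → ℝ) {N : ℕ → ℝ} (hN0 : ∀ j, 0 ≤ N j)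
    (hN : ∀ (U : Bg) (X : C.Dom), C.scale X ≤ k → |H U X| ≤ Real.exp (-(κ * C.d X)) * N (C.scale X))
    (c : ℝ) (y : ι) : T k s (c • H) y = c * T k s H y := by
  -- the ray function and its two properties
  have hray_add : ∀ a b : ℝ, T k s ((a + b) • H) y = T k s (a • H) y + T k s (b • H) y := by
    intro a b
    have h := hadd k s ((a + b) • H) (hsmul _ H hH) (b • H) (hsmul _ H hH) y
    rw [show (a + b) • H - b • H = a • H by rw [add_smul, add_sub_cancel_right]] at h
    linarith
  have hray_bd : ∀ a : ℝ, |T k s (a • H) y| ≤ (wt k y * ∑ j ∈ Finset.range (k + 1), τ k j * N j) * |a| := by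
    intro a
    have h := hsize k s (a • H) (hsmul a H hH) (fun j => |a| * N j) (fun j => mul_nonneg (abs_nonneg a) (hN0 j))
      (fun U X hX => abs_smul_apply_le a (hN U X hX)) y
    calc |T k s (a • H) y| ≤ wt k y * ∑ j ∈ Finset.range (k + 1), τ k j * (|a| * N j) := h
      _ = (wt k y * ∑ j ∈ Finset.range (k + 1), τ k j * N j) * |a| := by
          rw [mul_assoc, Finset.sum_mul]
          refine congrArg (wt k y * ·) (Finset.sum_congr rfl fun j _ => ?_)
          ring
  have key := eq_mul_of_additive_of_abs_le (φ := fun a : ℝ => T k s (a • H) y) hray_add hray_bd c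
  simpa only [one_smul] using key

/-- **THE CHANNEL IS ℝ-HOMOGENEOUS ON ONE-STEP SLICES** (per-creation-step size form — the shape K2♭'s per-slice readings
`Rd (j+n) j s` consume): `ChannelAdditive Adm T`, the guarded per-step size bound `ChannelSizeAtStepNN Adm T κ wt τ`, `Adm`
closed under differences and real scalars, a family `H ∈ Adm` SUPPORTED at the creation step `j ≤ k` with
`|H U X| ≤ e^{−κd(X)}·N` there (`N ≥ 0`) ⇒ `T k s (c•H) y = c·T k s H y`.
[cite: Balaban1988RG2Cluster, (1.23) p.7, p.8 l.9-10 and (1.36) p.9] -/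
theorem channel_smul_atStep (hadd : ChannelAdditive Adm T) (hstep : ChannelSizeAtStepNN Adm T κ wt τ)
    (hsmul : ∀ (c : ℝ), ∀ H ∈ Adm, c • H ∈ Adm)
    {H : Bg → C.Dom → ℝ} (hH : H ∈ Adm) {k j : ℕ} (hjk : j ≤ k) (s : ℕ → ℝ)
    (hsupp : ∀ (U : Bg) (X : C.Dom), C.scale X ≠ j → H U X = 0) {N : ℝ} (hN0 : 0 ≤ N)
    (hN : ∀ (U : Bg) (X : C.Dom), C.scale X = j → |H U X| ≤ Real.exp (-(κ * C.d X)) * N)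
    (c : ℝ) (y : ι) : T k s (c • H) y = c * T k s H y := by
  have hray_add : ∀ a b : ℝ, T k s ((a + b) • H) y = T k s (a • H) y + T k s (b • H) y := by
    intro a b
    have h := hadd k s ((a + b) • H) (hsmul _ H hH) (b • H) (hsmul _ H hH) y
    rw [show (a + b) • H - b • H = a • H by rw [add_smul, add_sub_cancel_right]] at h
    linarith
  have hray_bd : ∀ a : ℝ, |T k s (a • H) y| ≤ (wt k y * (τ k j * N)) * |a| := by
    intro a
    have hsupp' : ∀ (U : Bg) (X : C.Dom), C.scale X ≠ j → (a • H) U X = 0 := fun U X hX => by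
      rw [Pi.smul_apply, Pi.smul_apply, hsupp U X hX, smul_zero]
    have h := hstep k j hjk s (a • H) (hsmul a H hH) hsupp' (|a| * N) (mul_nonneg (abs_nonneg a) hN0)
      (fun U X hX => abs_smul_apply_le a (hN U X hX)) y
    calc |T k s (a • H) y| ≤ wt k y * (τ k j * (|a| * N)) := h
      _ = (wt k y * (τ k j * N)) * |a| := by ring
  have key := eq_mul_of_additive_of_abs_le (φ := fun a : ℝ => T k s (a • H) y) hray_add hray_bd c
  simpa only [one_smul] using key

/-! ## §3 The canonical complexification is ℂ-linear -/

/-- **THE COMPLEXIFIED CHANNEL IS ℂ-LINEAR, per-slice form**: for a pair `(H₁, H₂)` of admissible families supported at the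
creation step `j ≤ k` with profiles there, and a complex scalar `z = a + bi` acting on the pair as
`(a•H₁ − b•H₂, a•H₂ + b•H₁)`, the complex output `T H₁ + i·T H₂` is multiplied by `z`. [folklore] -/
theorem channel_complex_linear_atStep (hadd : ChannelAdditive Adm T) (hstep : ChannelSizeAtStepNN Adm T κ wt τ)
    (hsub : ∀ H₁ ∈ Adm, ∀ H₂ ∈ Adm, H₁ - H₂ ∈ Adm) (hsmul : ∀ (c : ℝ), ∀ H ∈ Adm, c • H ∈ Adm)
    {H₁ H₂ : Bg → C.Dom → ℝ} (h₁ : H₁ ∈ Adm) (h₂ : H₂ ∈ Adm) {k j : ℕ} (hjk : j ≤ k) (s : ℕ → ℝ)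
    (hsupp₁ : ∀ (U : Bg) (X : C.Dom), C.scale X ≠ j → H₁ U X = 0)
    (hsupp₂ : ∀ (U : Bg) (X : C.Dom), C.scale X ≠ j → H₂ U X = 0) {N₁ N₂ : ℝ} (hN₁ : 0 ≤ N₁) (hN₂ : 0 ≤ N₂)
    (hb₁ : ∀ (U : Bg) (X : C.Dom), C.scale X = j → |H₁ U X| ≤ Real.exp (-(κ * C.d X)) * N₁)
    (hb₂ : ∀ (U : Bg) (X : C.Dom), C.scale X = j → |H₂ U X| ≤ Real.exp (-(κ * C.d X)) * N₂)
    (a b : ℝ) (y : ι) :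
    (⟨T k s (a • H₁ - b • H₂) y, T k s (a • H₂ + b • H₁) y⟩ : ℂ) =
      (⟨a, b⟩ : ℂ) * ⟨T k s H₁ y, T k s H₂ y⟩ := by
  have hre : T k s (a • H₁ - b • H₂) y = a * T k s H₁ y - b * T k s H₂ y := by
    rw [hadd k s (a • H₁) (hsmul a H₁ h₁) (b • H₂) (hsmul b H₂ h₂) y,
      channel_smul_atStep hadd hstep hsmul h₁ hjk s hsupp₁ hN₁ hb₁ a y,
      channel_smul_atStep hadd hstep hsmul h₂ hjk s hsupp₂ hN₂ hb₂ b y]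
  have him : T k s (a • H₂ + b • H₁) y = a * T k s H₂ y + b * T k s H₁ y := by
    rw [channel_add hadd hsub hsmul (hsmul a H₂ h₂) (hsmul b H₁ h₁) k s y,
      channel_smul_atStep hadd hstep hsmul h₂ hjk s hsupp₂ hN₂ hb₂ a y,
      channel_smul_atStep hadd hstep hsmul h₁ hjk s hsupp₁ hN₁ hb₁ b y]
  apply Complex.ext
  · simp only [hre, Complex.mul_re]
  · simp only [him, Complex.mul_im]

/-- **THE COMPLEXIFIED CHANNEL IS ℂ-LINEAR, class-level form**: the same for admissible families with finite nonnegative profiles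
on the creation steps `≤ k` under `ChannelSizeNN`. [folklore] -/
theorem channel_complex_linear (hadd : ChannelAdditive Adm T) (hsize : ChannelSizeNN Adm T κ wt τ)
    (hsub : ∀ H₁ ∈ Adm, ∀ H₂ ∈ Adm, H₁ - H₂ ∈ Adm) (hsmul : ∀ (c : ℝ), ∀ H ∈ Adm, c • H ∈ Adm)
    {H₁ H₂ : Bg → C.Dom → ℝ} (h₁ : H₁ ∈ Adm) (h₂ : H₂ ∈ Adm) (k : ℕ) (s : ℕ → ℝ) {N₁ N₂ : ℕ → ℝ}
    (hN₁ : ∀ j, 0 ≤ N₁ j) (hN₂ : ∀ j, 0 ≤ N₂ j)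
    (hb₁ : ∀ (U : Bg) (X : C.Dom), C.scale X ≤ k → |H₁ U X| ≤ Real.exp (-(κ * C.d X)) * N₁ (C.scale X))
    (hb₂ : ∀ (U : Bg) (X : C.Dom), C.scale X ≤ k → |H₂ U X| ≤ Real.exp (-(κ * C.d X)) * N₂ (C.scale X))
    (a b : ℝ) (y : ι) :
    (⟨T k s (a • H₁ - b • H₂) y, T k s (a • H₂ + b • H₁) y⟩ : ℂ) =
      (⟨a, b⟩ : ℂ) * ⟨T k s H₁ y, T k s H₂ y⟩ := by
  have hre : T k s (a • H₁ - b • H₂) y = a * T k s H₁ y - b * T k s H₂ y := by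
    rw [hadd k s (a • H₁) (hsmul a H₁ h₁) (b • H₂) (hsmul b H₂ h₂) y,
      channel_smul hadd hsize hsmul h₁ k s hN₁ hb₁ a y, channel_smul hadd hsize hsmul h₂ k s hN₂ hb₂ b y]
  have him : T k s (a • H₂ + b • H₁) y = a * T k s H₂ y + b * T k s H₁ y := by
    rw [channel_add hadd hsub hsmul (hsmul a H₂ h₂) (hsmul b H₁ h₁) k s y,
      channel_smul hadd hsize hsmul h₂ k s hN₂ hb₂ a y, channel_smul hadd hsize hsmul h₁ k s hN₁ hb₁ b y]
  apply Complex.ext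
  · simp only [hre, Complex.mul_re]
  · simp only [him, Complex.mul_im]

/-- **THE COMPLEXIFIED CHANNEL IS ADDITIVE ON PAIRS** (no profile needed). [folklore] -/
theorem channel_complex_add (hadd : ChannelAdditive Adm T) (hsub : ∀ H₁ ∈ Adm, ∀ H₂ ∈ Adm, H₁ - H₂ ∈ Adm)
    (hsmul : ∀ (c : ℝ), ∀ H ∈ Adm, c • H ∈ Adm) {H₁ H₂ H₁' H₂' : Bg → C.Dom → ℝ} (h₁ : H₁ ∈ Adm) (h₂ : H₂ ∈ Adm)
    (h₁' : H₁' ∈ Adm) (h₂' : H₂' ∈ Adm) (k : ℕ) (s : ℕ → ℝ) (y : ι) :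
    (⟨T k s (H₁ + H₁') y, T k s (H₂ + H₂') y⟩ : ℂ) = ⟨T k s H₁ y, T k s H₂ y⟩ + ⟨T k s H₁' y, T k s H₂' y⟩ := by
  apply Complex.ext
  · simp only [Complex.add_re, channel_add hadd hsub hsmul h₁ h₁' k s y]
  · simp only [Complex.add_im, channel_add hadd hsub hsmul h₂ h₂' k s y]

/-! ## §4 The complexified channel obeys the same creation-step-weighted bound, times `√2` -/

/-- [folklore] `‖⟨u, v⟩‖_ℂ ≤ √2·M` from `|u| ≤ M` and `|v| ≤ M`. -/
theorem norm_mk_le_sqrt_two_mul {u v M : ℝ} (hu : |u| ≤ M) (hv : |v| ≤ M) : ‖(⟨u, v⟩ : ℂ)‖ ≤ Real.sqrt 2 * M := by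
  have h := Complex.norm_le_sqrt_two_mul_max (⟨u, v⟩ : ℂ)
  exact h.trans (mul_le_mul_of_nonneg_left (max_le hu hv) (Real.sqrt_nonneg _))

/-- **THE PER-SLICE BOUND OF THE COMPLEXIFIED CHANNEL**: both parts supported at the creation step `j ≤ k` with profile `N`
there ⇒ `‖(T k s H₁ y, T k s H₂ y)‖_ℂ ≤ √2·(wt k y·(τ k j·N))` — binder (B2)'s entry bound with `τ₀ωⁿ ↦ √2·τ (j+n) j`.
[cite: Balaban1988RG2Cluster, p.8 l.9-10 and (1.36) p.9] -/
theorem norm_channel_complex_le_atStep (hstep : ChannelSizeAtStepNN Adm T κ wt τ) {H₁ H₂ : Bg → C.Dom → ℝ}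
    (h₁ : H₁ ∈ Adm) (h₂ : H₂ ∈ Adm) {k j : ℕ} (hjk : j ≤ k) (s : ℕ → ℝ)
    (hsupp₁ : ∀ (U : Bg) (X : C.Dom), C.scale X ≠ j → H₁ U X = 0)
    (hsupp₂ : ∀ (U : Bg) (X : C.Dom), C.scale X ≠ j → H₂ U X = 0) {N : ℝ} (hN : 0 ≤ N)
    (hb₁ : ∀ (U : Bg) (X : C.Dom), C.scale X = j → |H₁ U X| ≤ Real.exp (-(κ * C.d X)) * N)
    (hb₂ : ∀ (U : Bg) (X : C.Dom), C.scale X = j → |H₂ U X| ≤ Real.exp (-(κ * C.d X)) * N) (y : ι) :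
    ‖(⟨T k s H₁ y, T k s H₂ y⟩ : ℂ)‖ ≤ Real.sqrt 2 * (wt k y * (τ k j * N)) :=
  norm_mk_le_sqrt_two_mul (hstep k j hjk s H₁ h₁ hsupp₁ N hN hb₁ y) (hstep k j hjk s H₂ h₂ hsupp₂ N hN hb₂ y)

/-- **THE CLASS-LEVEL BOUND OF THE COMPLEXIFIED CHANNEL**: both parts with the profile `N` on the creation steps `≤ k` ⇒
`‖(T k s H₁ y, T k s H₂ y)‖_ℂ ≤ √2·(wt k y·Σ_{j≤k} τ k j·N j)`. [cite: Balaban1988RG2Cluster, (1.36) p.9] -/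
theorem norm_channel_complex_le (hsize : ChannelSizeNN Adm T κ wt τ) {H₁ H₂ : Bg → C.Dom → ℝ} (h₁ : H₁ ∈ Adm)
    (h₂ : H₂ ∈ Adm) (k : ℕ) (s : ℕ → ℝ) {N : ℕ → ℝ} (hN : ∀ j, 0 ≤ N j)
    (hb₁ : ∀ (U : Bg) (X : C.Dom), C.scale X ≤ k → |H₁ U X| ≤ Real.exp (-(κ * C.d X)) * N (C.scale X))
    (hb₂ : ∀ (U : Bg) (X : C.Dom), C.scale X ≤ k → |H₂ U X| ≤ Real.exp (-(κ * C.d X)) * N (C.scale X)) (y : ι) :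
    ‖(⟨T k s H₁ y, T k s H₂ y⟩ : ℂ)‖ ≤ Real.sqrt 2 * (wt k y * ∑ j ∈ Finset.range (k + 1), τ k j * N j) :=
  norm_mk_le_sqrt_two_mul (hsize k s H₁ h₁ N hN hb₁ y) (hsize k s H₂ h₂ N hN hb₂ y)

/-- [folklore] A bound on the complex modulus of a pair of reals bounds each part. -/
theorem abs_re_im_le_of_norm_mk_le {u v B : ℝ} (h : ‖(⟨u, v⟩ : ℂ)‖ ≤ B) : |u| ≤ B ∧ |v| ≤ B :=
  ⟨(Complex.abs_re_le_norm ⟨u, v⟩).trans h, (Complex.abs_im_le_norm ⟨u, v⟩).trans h⟩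

/-- **THE PER-SLICE BOUND FROM A COMPLEX-MODULUS PROFILE**: if the pair is supported at the creation step `j ≤ k` and the
complex family `H₁ + i·H₂` obeys `‖(H₁ U X, H₂ U X)‖_ℂ ≤ e^{−κd(X)}·N` there, then
`‖(T k s H₁ y, T k s H₂ y)‖_ℂ ≤ √2·(wt k y·(τ k j·N))` — the form in which the slice space of record (weighted sup over
`(U, X)` of the complex modulus) feeds binder (B2). [cite: Balaban1988RG2Cluster, p.8 l.9-10 and (1.36) p.9] -/
theorem norm_channel_complex_le_atStep_of_complexBound (hstep : ChannelSizeAtStepNN Adm T κ wt τ)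
    {H₁ H₂ : Bg → C.Dom → ℝ} (h₁ : H₁ ∈ Adm) (h₂ : H₂ ∈ Adm) {k j : ℕ} (hjk : j ≤ k) (s : ℕ → ℝ)
    (hsupp₁ : ∀ (U : Bg) (X : C.Dom), C.scale X ≠ j → H₁ U X = 0)
    (hsupp₂ : ∀ (U : Bg) (X : C.Dom), C.scale X ≠ j → H₂ U X = 0) {N : ℝ} (hN : 0 ≤ N)
    (hb : ∀ (U : Bg) (X : C.Dom), C.scale X = j → ‖(⟨H₁ U X, H₂ U X⟩ : ℂ)‖ ≤ Real.exp (-(κ * C.d X)) * N) (y : ι) :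
    ‖(⟨T k s H₁ y, T k s H₂ y⟩ : ℂ)‖ ≤ Real.sqrt 2 * (wt k y * (τ k j * N)) :=
  norm_channel_complex_le_atStep hstep h₁ h₂ hjk s hsupp₁ hsupp₂ hN
    (fun U X hX => (abs_re_im_le_of_norm_mk_le (hb U X hX)).1) (fun U X hX => (abs_re_im_le_of_norm_mk_le (hb U X hX)).2) y

end Channel

end Summit.QuantumFields.BalabanUV.T4Continuum.NE9ChannelRealLinear
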